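import Literature.Topology.FourManifolds.AchiralLefschetzModel
import HarnessLib

/-!
# Topology of a page system: the trivialisation `M ∖ B ≅ int P × S¹`

Topic `Literature/Topology/FourManifolds`; proof file next to `AchiralLefschetzModel.lean` (theorems
only, no definitions, no named facts).
Layer 1 of the proof of the dictionary sub-lemma (E-d)
`IsPageSystem.finrank_singularHomology_one_eq_bettiNumber` (`PageSystemBetti.lean`): the point-set
topology of a page system `J : P × ℝ → M` of an open book `ob` of a `3`-manifold `M`
(`IsPageSystem ob J`, Etnyre–Fuller 2006, §2: *"`(∂X) ∖ B` is the `Σ`-bundle over `S¹`"*;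
J. B. Etnyre, *Lectures on open book decompositions and contact structures* (2006), §2).  The
connectedness of the binding for a page with connected boundary is `PageSystemBinding.lean`.

* `map_nhds_eq_of_contMDiffAt_of_injective_mfderiv` — the inverse function theorem at an INTERIOR
  point of a manifold with corners, in the weak form needed here: a `Cⁿ` map (`n ≠ 0`) between
  manifolds over finite-dimensional real models of the same dimension, with injective differential
  at an interior point `x`, maps the neighbourhood filter of `x` onto that of `f x` (Lee 2013,
  Thm. 4.5; Mathlib's `HasStrictFDerivAt.map_nhds_eq_of_equiv` read in extended charts, the chart
  of an interior point having the whole model range as a neighbourhood of its value).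
* `IsPageSystem.map_nhds_eq`, `IsPageSystem.apply_eq_apply_iff` — `J` is open at interior points and
  `J (q, θ) = J (q', θ') ↔ q = q' ∧ θ' - θ ∈ ℤ` on `int P × ℝ` (pages are read by `ob.proj`,
  `circlePt` is injective mod `1`, and `J (·, θ)` is injective).
* `IsPageSystem.exists_homeomorph` — **the global trivialisation** `Φ : int P × (ℝ/ℤ) ≃ₜ M ∖ B`,
  `Φ (q, θ) = J (q, θ)`: a continuous open bijection.

## References

* J. B. Etnyre, T. Fuller, *Realizing 4-manifolds as achiral Lefschetz fibrations*, IMRN 2006, §2.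
  [EtnyreFuller2006]
* J. M. Lee, *Introduction to Smooth Manifolds*, 2nd ed. (2013), Thm. 4.5. [LeeSmoothManifolds2013]
-/

noncomputable section

open scoped Manifold ContDiff Topology
open Set Filter Function Topology

namespace Literature.Topology.FourManifolds

universe u v

/-! ### The inverse function theorem at an interior point (filter form) -/

section IFT

variable {E : Type*} [NormedAddCommGroup E] [NormedSpace ℝ E] [FiniteDimensional ℝ E]
  {H : Type*} [TopologicalSpace H] {I : ModelWithCorners ℝ E H}
  {E' : Type*} [NormedAddCommGroup E'] [NormedSpace ℝ E'] [FiniteDimensional ℝ E']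
  {H' : Type*} [TopologicalSpace H'] {I' : ModelWithCorners ℝ E' H'} [I'.Boundaryless]
  {X : Type*} [TopologicalSpace X] [ChartedSpace H X]
  {Y : Type*} [TopologicalSpace Y] [ChartedSpace H' Y]

/-- **Inverse function theorem at an interior point, filter form** (Lee 2013, Thm. 4.5): if
`f : X → Y` is `Cⁿ` at `x` (`n ≠ 0`), `x` is an interior point of `X` (the target model being
boundaryless), the model spaces have the same finite dimension and `df_x` is injective, then
`f` maps the neighbourhood filter of `x` ONTO that of `f x` (so `f` is open near `x`).  Proof: the
chart expression `g = ψ ∘ f ∘ φ⁻¹` is `Cⁿ` at `φ x` with invertible derivative, since `range I` is a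
neighbourhood of `φ x`; Mathlib's `HasStrictFDerivAt.map_nhds_eq_of_equiv`; transport back along the
charts. [cite: LeeSmoothManifolds2013, Thm. 4.5] -/
theorem map_nhds_eq_of_contMDiffAt_of_injective_mfderiv {n : WithTop ℕ∞} {f : X → Y} {x : X}
    (hf : ContMDiffAt I I' n f x) (hn : n ≠ 0) (hx : I.IsInteriorPoint x)
    (hinj : Injective (mfderiv I I' f x))
    (hdim : Module.finrank ℝ E = Module.finrank ℝ E') :
    map f (𝓝 x) = 𝓝 (f x) := by
  set φ := extChartAt I x with hφ
  set ψ := extChartAt I' (f x) with hψ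
  set g : E → E' := ψ ∘ f ∘ φ.symm with hg
  have hrange : range I ∈ 𝓝 (φ x) := range_mem_nhds_isInteriorPoint hx
  obtain ⟨hcont, hdiff⟩ := contMDiffAt_iff.1 hf
  have hgn : ContDiffAt ℝ n g (φ x) := hdiff.contDiffAt hrange
  have hstrict : HasStrictFDerivAt g (fderiv ℝ g (φ x)) (φ x) := hgn.hasStrictFDerivAt hn
  have hmf : mfderiv I I' f x = fderiv ℝ g (φ x) := by
    rw [(hf.mdifferentiableAt hn).mfderiv, fderivWithin_of_mem_nhds hrange]
    rfl
  have hinj' : Injective (fderiv ℝ g (φ x)) := by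
    rw [← hmf]; exact hinj
  have hsurj' : Surjective (fderiv ℝ g (φ x)) :=
    (LinearMap.injective_iff_surjective_of_finrank_eq_finrank hdim
      (f := (fderiv ℝ g (φ x)).toLinearMap)).1 hinj'
  let L : E ≃L[ℝ] E' :=
    LinearEquiv.toContinuousLinearEquiv
      (LinearEquiv.ofBijective (fderiv ℝ g (φ x)).toLinearMap ⟨hinj', hsurj'⟩)
  have hL : (L : E →L[ℝ] E') = fderiv ℝ g (φ x) := by
    ext v; rfl
  have hstrictL : HasStrictFDerivAt g (L : E →L[ℝ] E') (φ x) := by rw [hL]; exact hstrict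
  have hmapg : map g (𝓝 (φ x)) = 𝓝 (g (φ x)) := hstrictL.map_nhds_eq_of_equiv
  -- `f` agrees with `ψ⁻¹ ∘ g ∘ φ` near `x`
  have heq : f =ᶠ[𝓝 x] ψ.symm ∘ g ∘ φ := by
    have h1 : ∀ᶠ z in 𝓝 x, z ∈ φ.source := extChartAt_source_mem_nhds x
    have h2 : ∀ᶠ z in 𝓝 x, f z ∈ ψ.source :=
      hcont.preimage_mem_nhds (extChartAt_source_mem_nhds (f x))
    filter_upwards [h1, h2] with z hz1 hz2
    simp only [hg, comp_apply]
    rw [φ.left_inv hz1, ψ.left_inv hz2]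
  have hgx : g (φ x) = ψ (f x) := by
    simp only [hg, comp_apply]
    rw [φ.left_inv (mem_extChartAt_source x)]
  rw [Filter.map_congr heq, ← Filter.map_map, ← Filter.map_map, hφ, map_extChartAt_nhds,
    nhdsWithin_eq_nhds.2 hrange]
  change map ψ.symm (map g (𝓝 (φ x))) = 𝓝 (f x)
  rw [hmapg, hgx, ← nhdsWithin_univ, ← ModelWithCorners.Boundaryless.range_eq_univ (I := I'), hψ]
  exact map_extChartAt_symm_nhdsWithin_range (I := I') (f x)

end IFT

/-! ### Page systems: injectivity mod `1`, openness, the trivialisation `int P × S¹ ≃ₜ M ∖ B` -/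

section PageSystem

variable {P : Type v} [TopologicalSpace P] [ChartedSpace (EuclideanHalfSpace 2) P]
  {M : Type u} [TopologicalSpace M] [ChartedSpace (EuclideanSpace ℝ (Fin 3)) M] [IsManifold (𝓡 3) ∞ M]
  {ob : Literature.Geometry.Symplectic.OpenBook M} {J : P × ℝ → M}

namespace IsPageSystem

/-- Periodicity under all integer shifts of the angle. [folklore] -/
theorem apply_add_int (hJ : IsPageSystem ob J) {q : P} (hq : q ∈ (𝓡∂ 2).interior P) (θ : ℝ)
    (m : ℤ) : J (q, θ + m) = J (q, θ) := by
  obtain ⟨n, rfl | rfl⟩ := m.eq_nat_or_neg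
  · exact_mod_cast hJ.apply_add_nat hq θ n
  · have h := hJ.apply_add_nat hq (θ + ((-(n : ℤ) : ℤ) : ℝ)) n
    rw [show θ + ((-(n : ℤ) : ℤ) : ℝ) + n = θ by push_cast; ring] at h
    exact h.symm

/-- **Two parametrised page points coincide iff they have the same page coordinate and angles
differing by an integer**: `J (q, θ) = J (q', θ') ↔ q = q' ∧ ∃ m : ℤ, θ' = θ + m` for
`q, q' ∈ int P` (the fibration `ob.proj` reads the angle `circlePt θ`, which determines `θ` mod `1`;
then periodicity and injectivity of `J (·, θ)`). [folklore] -/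
theorem apply_eq_apply_iff (hJ : IsPageSystem ob J) {q q' : P} (hq : q ∈ (𝓡∂ 2).interior P)
    (hq' : q' ∈ (𝓡∂ 2).interior P) (θ θ' : ℝ) :
    J (q, θ) = J (q', θ') ↔ q = q' ∧ ∃ m : ℤ, θ' = θ + m := by
  constructor
  · intro h
    have hc : circlePt θ' = circlePt θ := by
      rw [← hJ.proj_apply hq' θ', ← hJ.proj_apply hq θ, h]
    obtain ⟨m, hm⟩ := circlePt_eq_circlePt_iff.1 hc
    refine ⟨?_, m, hm⟩
    have h2 : J (q', θ') = J (q', θ) := by rw [hm, hJ.apply_add_int hq' θ m]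
    exact hJ.injOn θ hq hq' (h.trans h2)
  · rintro ⟨rfl, m, rfl⟩
    exact (hJ.apply_add_int hq θ m).symm

/-- `J` is continuous on `int P × ℝ`. [folklore] -/
theorem continuousOn (hJ : IsPageSystem ob J) :
    ContinuousOn J ((𝓡∂ 2).interior P ×ˢ (univ : Set ℝ)) :=
  hJ.contMDiffOn.continuousOn

/-- **`J` is open at interior points**: it maps the neighbourhood filter of `(q, θ)`, `q ∈ int P`,
onto that of `J (q, θ)` (an immersion between `3`-manifolds at an interior point; by the inverse
function theorem). [cite: EtnyreFuller2006, §2] -/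
theorem map_nhds_eq [IsManifold (𝓡∂ 2) ∞ P] (hJ : IsPageSystem ob J) {q : P}
    (hq : q ∈ (𝓡∂ 2).interior P) (θ : ℝ) : map J (𝓝 (q, θ)) = 𝓝 (J (q, θ)) := by
  have hint : ((𝓡∂ 2).prod 𝓘(ℝ, ℝ)).IsInteriorPoint (q, θ) := by
    change (q, θ) ∈ ((𝓡∂ 2).prod 𝓘(ℝ, ℝ)).interior (P × ℝ)
    rw [ModelWithCorners.interior_prod, ModelWithCorners.interior_eq_univ (M := ℝ)]
    exact ⟨hq, mem_univ _⟩
  refine map_nhds_eq_of_contMDiffAt_of_injective_mfderiv (hJ.contMDiffAt hq θ) (by simp) hint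
    (hJ.mfderiv_injective q hq θ) ?_
  simp [Module.finrank_prod]

/-- The parametrisation restricted to the open submanifold `int P × ℝ` is continuous. [folklore] -/
theorem continuous_comp_val (hJ : IsPageSystem ob J) :
    Continuous fun p : ↥((𝓡∂ 2).interior P) × ℝ => J ((p.1 : P), p.2) :=
  hJ.continuousOn.comp_continuous (f := fun p : ↥((𝓡∂ 2).interior P) × ℝ => ((p.1 : P), p.2))
    (by fun_prop) fun p => ⟨p.1.2, mem_univ _⟩

/-- The parametrisation restricted to the open submanifold `int P × ℝ` is an open map (it is open
at every point). [folklore] -/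
theorem isOpenMap_comp_val [IsManifold (𝓡∂ 2) ∞ P] (hJ : IsPageSystem ob J) :
    IsOpenMap fun p : ↥((𝓡∂ 2).interior P) × ℝ => J ((p.1 : P), p.2) := by
  have hopen : IsOpen ((𝓡∂ 2).interior P) :=
    ModelWithCorners.isOpen_interior (I := 𝓡∂ 2) (M := P) (n := ∞) (by simp)
  let ι : ↥((𝓡∂ 2).interior P) × ℝ → P × ℝ := Prod.map Subtype.val id
  have hι : IsOpenEmbedding ι := hopen.isOpenEmbedding_subtypeVal.prodMap IsOpenEmbedding.id
  have h : (fun p : ↥((𝓡∂ 2).interior P) × ℝ => J ((p.1 : P), p.2)) = J ∘ ι := rfl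
  rw [isOpenMap_iff_nhds_le]
  rintro ⟨q, θ⟩
  rw [h, ← Filter.map_map, hι.map_nhds_eq]
  change 𝓝 (J ((q : P), θ)) ≤ map J (𝓝 ((q : P), θ))
  rw [hJ.map_nhds_eq q.2 θ]

/-- **The global trivialisation of the open book off the binding**: a homeomorphism
`Φ : int P × (ℝ/ℤ) ≃ₜ M ∖ B` with `Φ (q, [θ]) = J (q, θ)` — the map is well defined (periodicity),
continuous and open (`J` is, and `ℝ → ℝ/ℤ` is an open quotient map), injective
(`apply_eq_apply_iff`) and surjective (`exists_eq`).  Etnyre–Fuller 2006, §2: `(∂X) ∖ B` is the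
`Σ`-bundle over `S¹`, here with its trivialisation. [cite: EtnyreFuller2006, §2] -/
theorem exists_homeomorph [IsManifold (𝓡∂ 2) ∞ P] [T2Space M] (hJ : IsPageSystem ob J) :
    ∃ Φ : ↥((𝓡∂ 2).interior P) × AddCircle (1 : ℝ) ≃ₜ ↥(ob.binding)ᶜ,
      ∀ (q : ↥((𝓡∂ 2).interior P)) (θ : ℝ),
        ((Φ (q, (θ : AddCircle (1 : ℝ))) : ↥(ob.binding)ᶜ) : M) = J ((q : P), θ) := by
  -- the lift `F` of the would-be trivialisation to `int P × ℝ`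
  let F : ↥((𝓡∂ 2).interior P) × ℝ → ↥(ob.binding)ᶜ :=
    fun p => ⟨J ((p.1 : P), p.2), hJ.apply_notMem_binding p.1.2 p.2⟩
  have hFc : Continuous F := hJ.continuous_comp_val.subtype_mk _
  have hFo : IsOpenMap F := by
    intro W hW
    rw [ob.isOpen_compl_binding.isOpenEmbedding_subtypeVal.isOpen_iff_image_isOpen, ← image_comp]
    exact hJ.isOpenMap_comp_val W hW
  have hper : ∀ q : ↥((𝓡∂ 2).interior P), Periodic (fun θ : ℝ => F (q, θ)) 1 := fun q θ =>
    Subtype.ext (hJ.periodic q q.2 θ)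
  -- the trivialisation `G` as a bare function
  let G : ↥((𝓡∂ 2).interior P) × AddCircle (1 : ℝ) → ↥(ob.binding)ᶜ :=
    fun p => (hper p.1).lift p.2
  have hG : ∀ (q : ↥((𝓡∂ 2).interior P)) (θ : ℝ), G (q, (θ : AddCircle (1 : ℝ))) = F (q, θ) :=
    fun q θ => (hper q).lift_coe θ
  let π : ↥((𝓡∂ 2).interior P) × ℝ → ↥((𝓡∂ 2).interior P) × AddCircle (1 : ℝ) :=
    Prod.map id (QuotientAddGroup.mk : ℝ → AddCircle (1 : ℝ))
  have hGπ : G ∘ π = F := by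
    ext ⟨q, θ⟩ : 1
    exact hG q θ
  have hπq : IsOpenQuotientMap π := IsOpenQuotientMap.id.prodMap QuotientAddGroup.isOpenQuotientMap_mk
  have hGc : Continuous G := by
    rw [← hπq.continuous_comp_iff, hGπ]
    exact hFc
  have hGo : IsOpenMap G := by
    intro W hW
    rw [← image_preimage_eq W hπq.surjective, ← image_comp, hGπ]
    exact hFo _ (hW.preimage hπq.continuous)
  have hGi : Injective G := by
    rintro ⟨q, t⟩ ⟨q', t'⟩ h
    induction t using QuotientAddGroup.induction_on with
    | H θ =>
    induction t' using QuotientAddGroup.induction_on with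
    | H θ' =>
    rw [hG, hG] at h
    have h' : J ((q : P), θ) = J ((q' : P), θ') := congrArg Subtype.val h
    obtain ⟨hqq, m, hm⟩ := (hJ.apply_eq_apply_iff q.2 q'.2 θ θ').1 h'
    refine Prod.ext (Subtype.ext hqq) ?_
    rw [QuotientAddGroup.eq_iff_sub_mem, AddSubgroup.mem_zmultiples_iff]
    exact ⟨-m, by rw [hm]; simp⟩
  have hGs : Surjective G := by
    rintro ⟨y, hy⟩
    obtain ⟨q, hq, θ, rfl⟩ := hJ.exists_eq y hy
    exact ⟨(⟨q, hq⟩, (θ : AddCircle (1 : ℝ))), by rw [hG]⟩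
  refine ⟨(Equiv.ofBijective G ⟨hGi, hGs⟩).toHomeomorphOfContinuousOpen hGc hGo, fun q θ => ?_⟩
  change ((G (q, (θ : AddCircle (1 : ℝ))) : ↥(ob.binding)ᶜ) : M) = _
  rw [hG]

end IsPageSystem

end PageSystem

end Literature.Topology.FourManifolds
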